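import Literature.MathematicalPhysics.QuantumLattice.HubbardNNNHoppingWeightedOpenBox
import HarnessLib

/-!
# The WEIGHTED Anderson cluster lower bound for the `t–t'–U` Hubbard model: cover identity, torus
# bound, thermodynamic limit, and the `2 × 3` table form

Topic `MathematicalPhysics/QuantumLattice`, family `hubbard` (seat hubbard-box-p3, S2 CERTIFIER-FAMILIES,
hypothesis-free tier). Sequel of `HubbardNNNHoppingWeightedOpenBox.lean` (the weighted open box
`h^W = hubbardOpenBoxTT'W r c τ υ ν`) and the weighted twin of `HubbardNNNHoppingClusterLowerBound.lean` /
`HubbardNNNHoppingClusterLowerBound2x3.lean` (uniform cover). Valentí–Stolze–Hirschfeld (1991) §II: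
Anderson's decomposition `H = Σ_clusters h` (Anderson 1951, eq. (2)) stays an operator identity when the
amplitude of each lattice bond and the repulsion of each site are distributed with POSITION-DEPENDENT
weights over the translated clusters covering it, provided the weights of all covering (cluster,
position) pairs add up to the lattice values; on-site potentials whose weights add up to zero may be
added freely. For the cover of the `a × b` torus by all translates of the open `r × c` box AND of its
transpose (the two orientations share the weights, transposed), the conditions read

  `wsumV τ + wsumH τ = t`,  `2·wsumD₁ τ = t'`,  `2·wsumD₂ τ = t'`,  `2·Σ_x υ x = U`,  `Σ_x ν x = 0`

(directional weight sums of `HubbardNNNHoppingWeightedOpenBox.lean`; `τ` symmetric), and then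

* `sum_fermionEmbed_boxTranslate_openBoxW` — ONE orientation: `Σ_g Γ(ι_g) h^W = -Σ_{p,q} τ(p,q)·T_{q-p}
  + (Σ υ)·Σ_x n_{x↑}n_{x↓} + (Σ ν)·N̂` (directed torus hoppings `T_d = hopDir`);
* `sum_smul_ite_boxAdj_hopDir` — the weighted bond count by direction:
  `Σ_{p,q} τ(p,q)·T_{q-p} = wsumV·(T_{e₁}+T_{-e₁}) + wsumH·(T_{e₂}+T_{-e₂}) + wsumD₁·(T_{e₁+e₂}+T_{-e₁-e₂})
  + wsumD₂·(T_{e₁-e₂}+T_{-e₁+e₂})`;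
* `sum_fermionEmbed_boxTranslate_openBoxW_symm` — **the weighted cover identity**:
  `Σ_g [Γ(ι_g) h^W_{r×c} + Γ(ι'_g) h^W_{c×r}(τᵀ)] = hubbardRectTorusTT' a b t t' U`;
* `groundEnergy_hubbardRectTorusTT'_ge_of_openBoxW_sectors` — **the weighted Anderson bound in
  certificate form**: sector floors `m ≤ E₀(h^W, k) + μ k` (`k ≤ 2rc`; ONE table, the transposed box has
  the same sector energies) give `2ab·m - 2rc·μ·N ≤ E₀(hubbardRectTorusTT' a b t t' U, N)`;
* `energyDensityTT'_ge_of_openBoxW_sectors`, `energyDensityTT'_ge_of_boxFloorsW_2x3` — the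
  thermodynamic limit `2m - 2rc·μ·n ≤ e(t,t',U;n)` and the `2 × 3` TABLE FORM
  `σ_k ≤ E₀(h^W_{2×3}, k), m ≤ σ_k + μk (k ≤ 12) ⇒ 2m - 12μn ≤ e(t,t',U;n)` — the drop-in replacement of
  `energyDensityTT'_ge_of_boxFloors_2x3` for the kernel `kacf2x3` certificates with weighted clusters
  (numerically +0.06…+0.09 t over the uniform weights `τ ≡ 1/7, 1/4`, `υ ≡ 1/12` at the cuprate cells).

References: Anderson, Phys. Rev. 83 (1951) 1260, eq. (2) [cite: Anderson1951, eq. (2)];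
Valentí–Stolze–Hirschfeld, Phys. Rev. B 43 (1991) 13743, §II [cite: ValentiStolzeHirschfeld1991, §II];
Lieb, arXiv:cond-mat/9311033 §2 (sectors) [cite: arXiv9311033, §2]; Ruelle 1969 §3.3 (thermodynamic
limit) [cite: Ruelle1969, §3.3]. Everything is proved; no definitions, no named facts. The coordinate
plumbing of Part II (translates, pair re-indexing) is file-private there and re-derived privately here.
-/

noncomputable section

namespace Literature.MathematicalPhysics.QuantumLattice

open Matrix Finset HubbardWave0 Filter Topology
open scoped ComplexOrder

namespace ClusterLowerBound

variable {a b r c : ℕ}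

/-! ### §1. Plumbing (file-private in Part II, re-derived) -/

/-- Two torus sites are equal iff their coordinates are. [folklore] -/
private theorem site_eq_iff' (x y : Fin a ×ₗ Fin b) :
    x = y ↔ ((ofLex x).1 : ℕ) = (ofLex y).1 ∧ ((ofLex x).2 : ℕ) = (ofLex y).2 := by
  constructor
  · rintro rfl; exact ⟨rfl, rfl⟩
  · rintro ⟨h1, h2⟩
    exact ofLex.injective (Prod.ext (Fin.ext h1) (Fin.ext h2))

/-- A full period is the identity translation. [folklore] -/
private theorem shiftPt_period' (x : Fin a ×ₗ Fin b) : shiftPt a b x = x := by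
  rw [site_eq_iff']
  change ((((ofLex x).1 : ℕ) + a) % a) = _ ∧ ((((ofLex x).2 : ℕ) + b) % b) = _
  rw [Nat.add_mod_right, Nat.add_mod_right, Nat.mod_eq_of_lt (ofLex x).1.isLt, Nat.mod_eq_of_lt (ofLex x).2.isLt]
  exact ⟨rfl, rfl⟩

/-- **Pair re-indexing** (Part II, private there): summing a two-point function over all translates of
a pair `(p, q)` of box sites gives the translation-summed two-point function at the vector `q - p`.
[cite: Anderson1951, eq. (2)] -/
private theorem sum_boxTranslate_pair' {M : Type*} [AddCommMonoid M] (hr : r ≤ a) (hc : c ≤ b)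
    (p q : Fin r ×ₗ Fin c) (F : Fin a ×ₗ Fin b → Fin a ×ₗ Fin b → M) :
    ∑ g, F (boxTranslate hr hc g p) (boxTranslate hr hc g q) =
      ∑ x, F x (shiftPt ((a - (ofLex p).1) + (ofLex q).1) ((b - (ofLex p).2) + (ofLex q).2) x) := by
  rw [← sum_shiftPt (a - (ofLex p).1) (b - (ofLex p).2)
    (fun g => F (boxTranslate hr hc g p) (boxTranslate hr hc g q))]
  refine Finset.sum_congr rfl fun x _ => ?_
  have hp1 := (ofLex p).1.isLt; have hp2 := (ofLex p).2.isLt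
  change F (shiftPt _ _ (shiftPt _ _ x)) (shiftPt _ _ (shiftPt _ _ x)) = _
  simp only [shiftPt_shiftPt]
  rw [Nat.sub_add_cancel (by omega : ((ofLex p).1 : ℕ) ≤ a), Nat.sub_add_cancel (by omega : ((ofLex p).2 : ℕ) ≤ b),
    shiftPt_period']

/-- A double indicator sum with a scalar weight factors through the weight sum. [folklore] -/
private theorem sum_sum_ite_smul {M : Type*} [AddCommMonoid M] [Module ℂ M]
    (P : Fin r ×ₗ Fin c → Fin r ×ₗ Fin c → Prop) [∀ p q, Decidable (P p q)]
    (f : Fin r ×ₗ Fin c → Fin r ×ₗ Fin c → ℝ) (T : M) :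
    (∑ p : Fin r ×ₗ Fin c, ∑ q : Fin r ×ₗ Fin c, if P p q then ((f p q : ℝ) : ℂ) • T else 0) =
      ((∑ p : Fin r ×ₗ Fin c, ∑ q : Fin r ×ₗ Fin c, if P p q then f p q else 0 : ℝ) : ℂ) • T := by
  rw [Complex.ofReal_sum, Finset.sum_smul]
  refine Finset.sum_congr rfl fun p _ => ?_
  rw [Complex.ofReal_sum, Finset.sum_smul]
  refine Finset.sum_congr rfl fun q _ => ?_
  split_ifs
  · rfl
  · rw [Complex.ofReal_zero, zero_smul]

/-! ### §2. The box bonds, one by one (weighted) -/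

/-- **Nearest-neighbour box bonds by direction**: `(p, q)` is a bond iff it is one of the four unit
steps, and then the translation-summed hopping is `T_{±e₁}`, `T_{±e₂}`. [cite: Anderson1951, eq. (2)] -/
private theorem ite_rectBoxGraph_adj_hopDir_pq (hr : r ≤ a) (hc : c ≤ b) (p q : Fin r ×ₗ Fin c) :
    (if (rectBoxGraph r c).Adj p q then
        hopDir a b ((a - (ofLex p).1) + (ofLex q).1) ((b - (ofLex p).2) + (ofLex q).2) else 0) =
      (if ((ofLex p).1 : ℕ) + 1 = (ofLex q).1 ∧ (ofLex p).2 = (ofLex q).2 then hopDir a b 1 0 else 0) +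
        (if ((ofLex q).1 : ℕ) + 1 = (ofLex p).1 ∧ (ofLex p).2 = (ofLex q).2 then hopDir a b (a - 1) 0 else 0) +
        (if (ofLex p).1 = (ofLex q).1 ∧ ((ofLex p).2 : ℕ) + 1 = (ofLex q).2 then hopDir a b 0 1 else 0) +
        (if (ofLex p).1 = (ofLex q).1 ∧ ((ofLex q).2 : ℕ) + 1 = (ofLex p).2 then hopDir a b 0 (b - 1) else 0) := by
  have hi := (ofLex p).1.isLt; have hi' := (ofLex q).1.isLt; have hj := (ofLex p).2.isLt; have hj' := (ofLex q).2.isLt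
  by_cases hA : (rectBoxGraph r c).Adj p q
  · rw [if_pos hA]
    change ((ofLex p).2 = (ofLex q).2 ∧ lineAdj (ofLex p).1 (ofLex q).1) ∨
      ((ofLex p).1 = (ofLex q).1 ∧ lineAdj (ofLex p).2 (ofLex q).2) at hA
    unfold lineAdj at hA
    rcases hA with ⟨hjj, h1 | h1⟩ | ⟨hii, h1 | h1⟩
    · have hjj' := congrArg Fin.val hjj
      have n2 : ¬(((ofLex q).1 : ℕ) + 1 = (ofLex p).1 ∧ (ofLex p).2 = (ofLex q).2) := fun h => by omega
      have n3 : ¬((ofLex p).1 = (ofLex q).1 ∧ ((ofLex p).2 : ℕ) + 1 = (ofLex q).2) := fun h => by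
        have := congrArg Fin.val h.1; omega
      have n4 : ¬((ofLex p).1 = (ofLex q).1 ∧ ((ofLex q).2 : ℕ) + 1 = (ofLex p).2) := fun h => by
        have := congrArg Fin.val h.1; omega
      rw [if_pos ⟨h1, hjj⟩, if_neg n2, if_neg n3, if_neg n4, add_zero, add_zero, add_zero,
        show a - ((ofLex p).1 : ℕ) + ((ofLex q).1 : ℕ) = 1 + a by omega,
        show b - ((ofLex p).2 : ℕ) + ((ofLex q).2 : ℕ) = 0 + b by omega,
        hopDir_add_period_fst, hopDir_add_period_snd]
    · have hjj' := congrArg Fin.val hjj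
      have n1 : ¬(((ofLex p).1 : ℕ) + 1 = (ofLex q).1 ∧ (ofLex p).2 = (ofLex q).2) := fun h => by omega
      have n3 : ¬((ofLex p).1 = (ofLex q).1 ∧ ((ofLex p).2 : ℕ) + 1 = (ofLex q).2) := fun h => by
        have := congrArg Fin.val h.1; omega
      have n4 : ¬((ofLex p).1 = (ofLex q).1 ∧ ((ofLex q).2 : ℕ) + 1 = (ofLex p).2) := fun h => by
        have := congrArg Fin.val h.1; omega
      rw [if_neg n1, if_pos ⟨h1, hjj⟩, if_neg n3, if_neg n4, zero_add, add_zero, add_zero,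
        show a - ((ofLex p).1 : ℕ) + ((ofLex q).1 : ℕ) = a - 1 by omega,
        show b - ((ofLex p).2 : ℕ) + ((ofLex q).2 : ℕ) = 0 + b by omega,
        hopDir_add_period_snd]
    · have hii' := congrArg Fin.val hii
      have n1 : ¬(((ofLex p).1 : ℕ) + 1 = (ofLex q).1 ∧ (ofLex p).2 = (ofLex q).2) := fun h => by omega
      have n2 : ¬(((ofLex q).1 : ℕ) + 1 = (ofLex p).1 ∧ (ofLex p).2 = (ofLex q).2) := fun h => by omega
      have n4 : ¬((ofLex p).1 = (ofLex q).1 ∧ ((ofLex q).2 : ℕ) + 1 = (ofLex p).2) := fun h => by omega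
      rw [if_neg n1, if_neg n2, if_pos ⟨hii, h1⟩, if_neg n4, zero_add, zero_add, add_zero,
        show a - ((ofLex p).1 : ℕ) + ((ofLex q).1 : ℕ) = 0 + a by omega,
        show b - ((ofLex p).2 : ℕ) + ((ofLex q).2 : ℕ) = 1 + b by omega,
        hopDir_add_period_fst, hopDir_add_period_snd]
    · have hii' := congrArg Fin.val hii
      have n1 : ¬(((ofLex p).1 : ℕ) + 1 = (ofLex q).1 ∧ (ofLex p).2 = (ofLex q).2) := fun h => by omega
      have n2 : ¬(((ofLex q).1 : ℕ) + 1 = (ofLex p).1 ∧ (ofLex p).2 = (ofLex q).2) := fun h => by omega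
      have n3 : ¬((ofLex p).1 = (ofLex q).1 ∧ ((ofLex p).2 : ℕ) + 1 = (ofLex q).2) := fun h => by omega
      rw [if_neg n1, if_neg n2, if_neg n3, if_pos ⟨hii, h1⟩, zero_add, zero_add, zero_add,
        show a - ((ofLex p).1 : ℕ) + ((ofLex q).1 : ℕ) = 0 + a by omega,
        show b - ((ofLex p).2 : ℕ) + ((ofLex q).2 : ℕ) = b - 1 by omega,
        hopDir_add_period_fst]
  · rw [if_neg hA]
    change ¬(((ofLex p).2 = (ofLex q).2 ∧ lineAdj (ofLex p).1 (ofLex q).1) ∨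
      ((ofLex p).1 = (ofLex q).1 ∧ lineAdj (ofLex p).2 (ofLex q).2)) at hA
    unfold lineAdj at hA
    rw [if_neg (fun h => hA (Or.inl ⟨h.2, Or.inl h.1⟩)), if_neg (fun h => hA (Or.inl ⟨h.2, Or.inr h.1⟩)),
      if_neg (fun h => hA (Or.inr ⟨h.1, Or.inl h.2⟩)), if_neg (fun h => hA (Or.inr ⟨h.1, Or.inr h.2⟩)),
      add_zero, add_zero, add_zero]

/-- **Diagonal box bonds by direction**: the four diagonal steps and `T_{±e₁ ± e₂}`. [cite: Anderson1951, eq. (2)] -/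
private theorem ite_rectBoxDiagGraph_adj_hopDir_pq (hr : r ≤ a) (hc : c ≤ b) (p q : Fin r ×ₗ Fin c) :
    (if (rectBoxDiagGraph r c).Adj p q then
        hopDir a b ((a - (ofLex p).1) + (ofLex q).1) ((b - (ofLex p).2) + (ofLex q).2) else 0) =
      (if ((ofLex p).1 : ℕ) + 1 = (ofLex q).1 ∧ ((ofLex p).2 : ℕ) + 1 = (ofLex q).2 then hopDir a b 1 1 else 0) +
        (if ((ofLex p).1 : ℕ) + 1 = (ofLex q).1 ∧ ((ofLex q).2 : ℕ) + 1 = (ofLex p).2 then hopDir a b 1 (b - 1) else 0) +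
        (if ((ofLex q).1 : ℕ) + 1 = (ofLex p).1 ∧ ((ofLex p).2 : ℕ) + 1 = (ofLex q).2 then hopDir a b (a - 1) 1 else 0) +
        (if ((ofLex q).1 : ℕ) + 1 = (ofLex p).1 ∧ ((ofLex q).2 : ℕ) + 1 = (ofLex p).2 then
          hopDir a b (a - 1) (b - 1) else 0) := by
  have hi := (ofLex p).1.isLt; have hi' := (ofLex q).1.isLt; have hj := (ofLex p).2.isLt; have hj' := (ofLex q).2.isLt
  by_cases hA : (rectBoxDiagGraph r c).Adj p q
  · rw [if_pos hA]
    change lineAdj (ofLex p).1 (ofLex q).1 ∧ lineAdj (ofLex p).2 (ofLex q).2 at hA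
    unfold lineAdj at hA
    rcases hA with ⟨h1 | h1, h2 | h2⟩
    · rw [if_pos ⟨h1, h2⟩, if_neg (fun h => by omega), if_neg (fun h => by omega), if_neg (fun h => by omega),
        add_zero, add_zero, add_zero,
        show a - ((ofLex p).1 : ℕ) + ((ofLex q).1 : ℕ) = 1 + a by omega,
        show b - ((ofLex p).2 : ℕ) + ((ofLex q).2 : ℕ) = 1 + b by omega,
        hopDir_add_period_fst, hopDir_add_period_snd]
    · rw [if_neg (fun h => by omega), if_pos ⟨h1, h2⟩, if_neg (fun h => by omega), if_neg (fun h => by omega),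
        zero_add, add_zero, add_zero,
        show a - ((ofLex p).1 : ℕ) + ((ofLex q).1 : ℕ) = 1 + a by omega,
        show b - ((ofLex p).2 : ℕ) + ((ofLex q).2 : ℕ) = b - 1 by omega,
        hopDir_add_period_fst]
    · rw [if_neg (fun h => by omega), if_neg (fun h => by omega), if_pos ⟨h1, h2⟩, if_neg (fun h => by omega),
        zero_add, zero_add, add_zero,
        show a - ((ofLex p).1 : ℕ) + ((ofLex q).1 : ℕ) = a - 1 by omega,
        show b - ((ofLex p).2 : ℕ) + ((ofLex q).2 : ℕ) = 1 + b by omega,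
        hopDir_add_period_snd]
    · rw [if_neg (fun h => by omega), if_neg (fun h => by omega), if_neg (fun h => by omega), if_pos ⟨h1, h2⟩,
        zero_add, zero_add, zero_add,
        show a - ((ofLex p).1 : ℕ) + ((ofLex q).1 : ℕ) = a - 1 by omega,
        show b - ((ofLex p).2 : ℕ) + ((ofLex q).2 : ℕ) = b - 1 by omega]
  · rw [if_neg hA]
    change ¬(lineAdj (ofLex p).1 (ofLex q).1 ∧ lineAdj (ofLex p).2 (ofLex q).2) at hA
    unfold lineAdj at hA
    rw [if_neg (fun h => hA ⟨Or.inl h.1, Or.inl h.2⟩), if_neg (fun h => hA ⟨Or.inl h.1, Or.inr h.2⟩),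
      if_neg (fun h => hA ⟨Or.inr h.1, Or.inl h.2⟩), if_neg (fun h => hA ⟨Or.inr h.1, Or.inr h.2⟩),
      add_zero, add_zero, add_zero]

/-- **Weighted bond count by direction.** For symmetric weights `τ`,
`Σ_{p,q} τ(p,q)·T_{q-p} = wsumV·(T_{e₁} + T_{-e₁}) + wsumH·(T_{e₂} + T_{-e₂}) + wsumD₁·(T_{e₁+e₂} + T_{-e₁-e₂})
+ wsumD₂·(T_{e₁-e₂} + T_{-e₁+e₂})`. [cite: ValentiStolzeHirschfeld1991, §II] -/
theorem sum_smul_ite_boxAdj_hopDir (hr : r ≤ a) (hc : c ≤ b) (τ : Fin r ×ₗ Fin c → Fin r ×ₗ Fin c → ℝ)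
    (hτ : ∀ x y, τ x y = τ y x) :
    (∑ p : Fin r ×ₗ Fin c, ∑ q : Fin r ×ₗ Fin c, ((τ p q : ℝ) : ℂ) •
        (if (rectBoxGraph r c).Adj p q ∨ (rectBoxDiagGraph r c).Adj p q then
          hopDir a b ((a - (ofLex p).1) + (ofLex q).1) ((b - (ofLex p).2) + (ofLex q).2) else 0)) =
      ((wsumV τ : ℝ) : ℂ) • (hopDir a b 1 0 + hopDir a b (a - 1) 0) +
        ((wsumH τ : ℝ) : ℂ) • (hopDir a b 0 1 + hopDir a b 0 (b - 1)) +
        ((wsumD₁ τ : ℝ) : ℂ) • (hopDir a b 1 1 + hopDir a b (a - 1) (b - 1)) +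
        ((wsumD₂ τ : ℝ) : ℂ) • (hopDir a b 1 (b - 1) + hopDir a b (a - 1) 1) := by
  have split : ∀ p q : Fin r ×ₗ Fin c, ((τ p q : ℝ) : ℂ) •
      (if (rectBoxGraph r c).Adj p q ∨ (rectBoxDiagGraph r c).Adj p q then
        hopDir a b ((a - (ofLex p).1) + (ofLex q).1) ((b - (ofLex p).2) + (ofLex q).2) else 0) =
      (if ((ofLex p).1 : ℕ) + 1 = (ofLex q).1 ∧ (ofLex p).2 = (ofLex q).2 then ((τ p q : ℝ) : ℂ) • hopDir a b 1 0 else 0) +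
      (if ((ofLex q).1 : ℕ) + 1 = (ofLex p).1 ∧ (ofLex p).2 = (ofLex q).2 then
        ((τ p q : ℝ) : ℂ) • hopDir a b (a - 1) 0 else 0) +
      (if (ofLex p).1 = (ofLex q).1 ∧ ((ofLex p).2 : ℕ) + 1 = (ofLex q).2 then ((τ p q : ℝ) : ℂ) • hopDir a b 0 1 else 0) +
      (if (ofLex p).1 = (ofLex q).1 ∧ ((ofLex q).2 : ℕ) + 1 = (ofLex p).2 then
        ((τ p q : ℝ) : ℂ) • hopDir a b 0 (b - 1) else 0) +
      ((if ((ofLex p).1 : ℕ) + 1 = (ofLex q).1 ∧ ((ofLex p).2 : ℕ) + 1 = (ofLex q).2 then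
          ((τ p q : ℝ) : ℂ) • hopDir a b 1 1 else 0) +
        (if ((ofLex p).1 : ℕ) + 1 = (ofLex q).1 ∧ ((ofLex q).2 : ℕ) + 1 = (ofLex p).2 then
          ((τ p q : ℝ) : ℂ) • hopDir a b 1 (b - 1) else 0) +
        (if ((ofLex q).1 : ℕ) + 1 = (ofLex p).1 ∧ ((ofLex p).2 : ℕ) + 1 = (ofLex q).2 then
          ((τ p q : ℝ) : ℂ) • hopDir a b (a - 1) 1 else 0) +
        (if ((ofLex q).1 : ℕ) + 1 = (ofLex p).1 ∧ ((ofLex q).2 : ℕ) + 1 = (ofLex p).2 then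
          ((τ p q : ℝ) : ℂ) • hopDir a b (a - 1) (b - 1) else 0)) := by
    intro p q
    have hor : (if (rectBoxGraph r c).Adj p q ∨ (rectBoxDiagGraph r c).Adj p q then
        hopDir a b ((a - (ofLex p).1) + (ofLex q).1) ((b - (ofLex p).2) + (ofLex q).2) else (0 : Matrix _ _ ℂ)) =
        (if (rectBoxGraph r c).Adj p q then
          hopDir a b ((a - (ofLex p).1) + (ofLex q).1) ((b - (ofLex p).2) + (ofLex q).2) else 0) +
        (if (rectBoxDiagGraph r c).Adj p q then
          hopDir a b ((a - (ofLex p).1) + (ofLex q).1) ((b - (ofLex p).2) + (ofLex q).2) else 0) := by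
      by_cases h1 : (rectBoxGraph r c).Adj p q
      · rw [if_pos (Or.inl h1), if_pos h1, if_neg (not_rectBoxDiagGraph_adj_of_rectBoxGraph_adj h1), add_zero]
      · by_cases h2 : (rectBoxDiagGraph r c).Adj p q
        · rw [if_pos (Or.inr h2), if_neg h1, if_pos h2, zero_add]
        · rw [if_neg (fun h => h.elim h1 h2), if_neg h1, if_neg h2, add_zero]
    rw [hor, smul_add, ite_rectBoxGraph_adj_hopDir_pq hr hc, ite_rectBoxDiagGraph_adj_hopDir_pq hr hc]
    simp only [smul_add, smul_ite, smul_zero]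
  simp_rw [split]
  simp only [Finset.sum_add_distrib]
  rw [sum_sum_ite_smul, sum_sum_ite_smul, sum_sum_ite_smul, sum_sum_ite_smul, sum_sum_ite_smul, sum_sum_ite_smul,
    sum_sum_ite_smul, sum_sum_ite_smul, wsumV_reverse τ hτ, wsumH_reverse τ hτ, wsumD₁_reverse τ hτ, wsumD₂_reverse τ hτ]
  rw [show (∑ p : Fin r ×ₗ Fin c, ∑ q : Fin r ×ₗ Fin c,
      if ((ofLex p).1 : ℕ) + 1 = (ofLex q).1 ∧ (ofLex p).2 = (ofLex q).2 then τ p q else 0) = wsumV τ from rfl,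
    show (∑ p : Fin r ×ₗ Fin c, ∑ q : Fin r ×ₗ Fin c,
      if (ofLex p).1 = (ofLex q).1 ∧ ((ofLex p).2 : ℕ) + 1 = (ofLex q).2 then τ p q else 0) = wsumH τ from rfl,
    show (∑ p : Fin r ×ₗ Fin c, ∑ q : Fin r ×ₗ Fin c,
      if ((ofLex p).1 : ℕ) + 1 = (ofLex q).1 ∧ ((ofLex p).2 : ℕ) + 1 = (ofLex q).2 then τ p q else 0) = wsumD₁ τ from rfl,
    show (∑ p : Fin r ×ₗ Fin c, ∑ q : Fin r ×ₗ Fin c,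
      if ((ofLex p).1 : ℕ) + 1 = (ofLex q).1 ∧ ((ofLex q).2 : ℕ) + 1 = (ofLex p).2 then τ p q else 0) = wsumD₂ τ from rfl]
  simp only [smul_add]
  abel

/-! ### §3. The weighted cover identities -/

/-- **Cover identity for one box orientation (weighted)**: summing the embedded weighted open-box
Hamiltonian over all `a·b` translates of the `r × c` box gives the weighted directed hoppings, the
repulsion with total weight `Σ υ` and the particle number with total weight `Σ ν`.
[cite: ValentiStolzeHirschfeld1991, §II] -/
theorem sum_fermionEmbed_boxTranslate_openBoxW (hr : r ≤ a) (hc : c ≤ b)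
    (τ : Fin r ×ₗ Fin c → Fin r ×ₗ Fin c → ℝ) (υ ν : Fin r ×ₗ Fin c → ℝ) :
    ∑ g, fermionEmbed (boxTranslate hr hc g) (hubbardOpenBoxTT'W r c τ υ ν) =
      -(∑ p : Fin r ×ₗ Fin c, ∑ q : Fin r ×ₗ Fin c, ((τ p q : ℝ) : ℂ) •
          (if (rectBoxGraph r c).Adj p q ∨ (rectBoxDiagGraph r c).Adj p q then
            hopDir a b ((a - (ofLex p).1) + (ofLex q).1) ((b - (ofLex p).2) + (ofLex q).2) else 0)) +
        ((∑ p : Fin r ×ₗ Fin c, υ p : ℝ) : ℂ) • (∑ x : Fin a ×ₗ Fin b, numberOp x 0 * numberOp x 1) +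
        ((∑ p : Fin r ×ₗ Fin c, ν p : ℝ) : ℂ) • (∑ x : Fin a ×ₗ Fin b, (numberOp x 0 + numberOp x 1)) := by
  unfold hubbardOpenBoxTT'W
  simp_rw [fermionEmbed_add, fermionEmbed_neg, fermionEmbed_sum]
  rw [Finset.sum_add_distrib, Finset.sum_add_distrib, Finset.sum_neg_distrib]
  congr 1
  congr 1
  · congr 1
    rw [Finset.sum_comm]
    refine Finset.sum_congr rfl fun p _ => ?_
    rw [Finset.sum_comm]
    refine Finset.sum_congr rfl fun q _ => ?_
    by_cases hA : (rectBoxGraph r c).Adj p q ∨ (rectBoxDiagGraph r c).Adj p q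
    · simp_rw [if_pos hA, fermionEmbed_smul, fermionEmbed_mul, fermionEmbed_creation, fermionEmbed_annihilation]
      simp_rw [← Finset.smul_sum]
      rw [hopDir, sum_boxTranslate_pair' hr hc p q (fun x y => ∑ σ : Fin 2, creation (orb x σ) * annihilation (orb y σ))]
    · simp_rw [if_neg hA, fermionEmbed_zero, Finset.sum_const_zero, smul_zero]
  · simp_rw [fermionEmbed_smul, fermionEmbed_mul, fermionEmbed_numberOp]
    rw [Finset.sum_comm, Complex.ofReal_sum, Finset.sum_smul]
    refine Finset.sum_congr rfl fun p _ => ?_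
    rw [← Finset.smul_sum, sum_boxTranslate_pair' hr hc p p (fun x _ => numberOp x 0 * numberOp x 1)]
  · simp_rw [fermionEmbed_smul, fermionEmbed_add, fermionEmbed_numberOp]
    rw [Finset.sum_comm, Complex.ofReal_sum, Finset.sum_smul]
    refine Finset.sum_congr rfl fun p _ => ?_
    rw [← Finset.smul_sum, sum_boxTranslate_pair' hr hc p p (fun x _ => numberOp x 0 + numberOp x 1)]

/-- The total particle number as a site sum. [folklore] -/
private theorem sum_numberOp_add_eq_totalNumber :
    (∑ x : Fin a ×ₗ Fin b, (numberOp x 0 + numberOp x 1 : Matrix (Finset (Orb (Fin a ×ₗ Fin b))) _ ℂ)) = totalNumber := by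
  rw [totalNumber]
  exact Finset.sum_congr rfl fun x _ => (Fin.sum_univ_two _).symm

/-- **THE WEIGHTED COVER IDENTITY** (box and transposed box, shared transposed weights; `a, b ≥ 3`,
`r, c ≤ min a b`, `τ` symmetric): if `wsumV τ + wsumH τ = t`, `2 wsumD₁ τ = t'`, `2 wsumD₂ τ = t'`,
`2 Σ υ = U` and `Σ ν = 0`, then
`Σ_g [Γ(ι_g) h^W_{r×c}(τ,υ,ν) + Γ(ι'_g) h^W_{c×r}(τᵀ,υᵀ,νᵀ)] = hubbardRectTorusTT' a b t t' U` — the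
decomposition `H = Σ_C h_C` behind the weighted cluster lower bound. [cite: ValentiStolzeHirschfeld1991, §II] -/
theorem sum_fermionEmbed_boxTranslate_openBoxW_symm (ha : 3 ≤ a) (hb : 3 ≤ b) (hr : r ≤ a) (hc : c ≤ b)
    (hc' : c ≤ a) (hr' : r ≤ b) (τ : Fin r ×ₗ Fin c → Fin r ×ₗ Fin c → ℝ) (hτ : ∀ x y, τ x y = τ y x)
    (υ ν : Fin r ×ₗ Fin c → ℝ) {t t' U : ℝ} (ht : wsumV τ + wsumH τ = t) (hd₁ : 2 * wsumD₁ τ = t')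
    (hd₂ : 2 * wsumD₂ τ = t') (hU : 2 * ∑ p, υ p = U) (hν : ∑ p, ν p = 0) :
    ∑ g, (fermionEmbed (boxTranslate hr hc g) (hubbardOpenBoxTT'W r c τ υ ν) +
        fermionEmbed (boxTranslate hc' hr' g) (hubbardOpenBoxTT'W c r (fun p q => τ (rectSwap c r p) (rectSwap c r q))
          (fun p => υ (rectSwap c r p)) (fun p => ν (rectSwap c r p)))) =
      hubbardRectTorusTT' a b t t' U := by
  have hτ' : ∀ x y : Fin c ×ₗ Fin r, (fun p q => τ (rectSwap c r p) (rectSwap c r q)) x y =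
      (fun p q => τ (rectSwap c r p) (rectSwap c r q)) y x := fun x y => hτ _ _
  have hυ' : (∑ p : Fin c ×ₗ Fin r, υ (rectSwap c r p)) = ∑ p, υ p := (rectSwap c r).sum_comp υ
  have hν' : (∑ p : Fin c ×ₗ Fin r, ν (rectSwap c r p)) = ∑ p, ν p := (rectSwap c r).sum_comp ν
  rw [Finset.sum_add_distrib, sum_fermionEmbed_boxTranslate_openBoxW hr hc, sum_fermionEmbed_boxTranslate_openBoxW hc' hr',
    sum_smul_ite_boxAdj_hopDir hr hc τ hτ, sum_smul_ite_boxAdj_hopDir hc' hr' _ hτ', wsumV_transpose, wsumH_transpose,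
    wsumD₁_transpose, wsumD₂_transpose τ hτ, hυ', hν', hν, sum_numberOp_add_eq_totalNumber, hubbardRectTorusTT',
    hamiltonian_fermionRectTorusGraph_eq_hopDir ha hb, hamiltonian_fermionRectTorusDiagGraph_eq_hopDir ha hb,
    ← ht, ← hU, Complex.ofReal_zero, zero_smul, add_zero, add_zero]
  have hd : wsumD₂ τ = wsumD₁ τ := by linarith
  rw [hd, ← hd₁]
  push_cast
  module

/-! ### §4. The weighted Anderson bound on the torus -/

/-- A finite sum of positive semidefinite matrices is positive semidefinite. [folklore] -/
private theorem posSemidef_sum' {ι n : Type*} [Fintype n] (S : Finset ι) (f : ι → Matrix n n ℂ)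
    (h : ∀ i ∈ S, (f i).PosSemidef) : (∑ i ∈ S, f i).PosSemidef := by
  classical
  induction S using Finset.induction_on with
  | empty => rw [Finset.sum_empty]; exact Matrix.PosSemidef.zero
  | @insert i S hi ih =>
    rw [Finset.sum_insert hi]
    exact (h i (Finset.mem_insert_self i S)).add (ih fun j hj => h j (Finset.mem_insert_of_mem hj))

/-- From `H + κ N̂ - C ⪰ 0` on the torus Fock space to `C - κ N ≤ E₀(H, N)`. [cite: arXiv9311033, §2] -/
private theorem groundEnergy_ge_of_posSemidef_add_smul_totalNumber'
    (H : Matrix (Finset (Orb (Fin a ×ₗ Fin b))) (Finset (Orb (Fin a ×ₗ Fin b))) ℂ) (κ C : ℝ)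
    (hpos : (H + (κ : ℂ) • totalNumber - (C : ℂ) • 1).PosSemidef) {N : ℕ} (hN : N ≤ 2 * (a * b)) :
    C - κ * N ≤ groundEnergy H N := by
  have hN' : N ≤ Fintype.card (Orb (Fin a ×ₗ Fin b)) := by rw [card_orb, card_rectSites]; exact hN
  refine le_groundEnergy_of_posSemidef_sub_sector hN'
    (K := (-(κ : ℂ)) • ((totalNumber : Matrix (Finset (Orb (Fin a ×ₗ Fin b))) _ ℂ) - (N : ℂ) • 1))
    (fun ψ hψ => ?_) ?_
  · rw [smul_mulVec, sub_mulVec, totalNumber_mulVec_of_isNParticle hψ, smul_mulVec, one_mulVec,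
      sub_self, smul_zero, dotProduct_zero]
  · convert hpos using 1
    push_cast
    module

/-- A Hermitian operator plus a real multiple of `N̂` is Hermitian. [folklore] -/
private theorem isHermitian_add_smul_totalNumber' {Λ : Type*} [LinearOrder Λ] [Fintype Λ]
    {H : Matrix (Finset (Orb Λ)) (Finset (Orb Λ)) ℂ} (hH : H.IsHermitian) (μ : ℝ) :
    (H + (μ : ℂ) • (totalNumber : Matrix (Finset (Orb Λ)) _ ℂ)).IsHermitian := by
  refine hH.add ?_
  have hN : (totalNumber : Matrix (Finset (Orb Λ)) _ ℂ).IsHermitian := by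
    rw [← totalNumberOp_eq_totalNumber, totalNumberOp_eq_diagonal]
    exact Matrix.isHermitian_diagonal_of_self_adjoint _ (funext fun s => by simp)
  unfold Matrix.IsHermitian
  rw [conjTranspose_smul, hN.eq, Complex.star_def, Complex.conj_ofReal]

/-- Sector floors shifted by a chemical potential: `m ≤ E₀(H, k) + μ k ⇒ m ≤ E₀(H + μ N̂, k)`.
[cite: arXiv9311033, §2] -/
private theorem le_groundEnergy_add_smul_totalNumber' {Λ : Type*} [LinearOrder Λ] [Fintype Λ]
    (H : Matrix (Finset (Orb Λ)) (Finset (Orb Λ)) ℂ) (μ m : ℝ) {k : ℕ} (hk : k ≤ 2 * Fintype.card Λ)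
    (h : m ≤ groundEnergy H k + μ * k) :
    m ≤ groundEnergy (H + (μ : ℂ) • (totalNumber : Matrix (Finset (Orb Λ)) _ ℂ)) k := by
  have hk' : k ≤ Fintype.card (Orb Λ) := by rw [card_orb]; exact hk
  unfold groundEnergy
  refine le_csInf (ThermodynamicLimit.groundEnergySet_nonempty _ hk') ?_
  rintro E ⟨ψ, hψN, hψ1, rfl⟩
  have h1 := ThermodynamicLimit.groundEnergy_le_re_expect H hψN hψ1
  have h2 : (expect (H + (μ : ℂ) • (totalNumber : Matrix (Finset (Orb Λ)) _ ℂ)) ψ).re =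
      (expect H ψ).re + μ * k := by
    unfold expect
    rw [add_mulVec, smul_mulVec, totalNumber_mulVec_of_isNParticle hψN, dotProduct_add, dotProduct_smul,
      dotProduct_smul, hψ1, Complex.add_re, smul_eq_mul, smul_eq_mul, mul_one,
      show ((k : ℕ) : ℂ) = ((k : ℝ) : ℂ) by norm_cast, ← Complex.ofReal_mul, Complex.ofReal_re]
  rw [h2]
  linarith

/-- **Sector floors of the weighted box ⇒ the operator hypothesis**: `m ≤ E₀(h^W, k) + μ k` for all
`k ≤ 2rc` gives `h^W + μ N̂ - m ⪰ 0` on the box Fock space (`τ` symmetric). [cite: arXiv9311033, §2] -/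
theorem posSemidef_openBoxW_add_smul_totalNumber_of_sectors (τ : Fin r ×ₗ Fin c → Fin r ×ₗ Fin c → ℝ)
    (hτ : ∀ x y, τ x y = τ y x) (υ ν : Fin r ×ₗ Fin c → ℝ) (μ m : ℝ)
    (hm : ∀ k ≤ 2 * (r * c), m ≤ groundEnergy (hubbardOpenBoxTT'W r c τ υ ν) k + μ * k) :
    (hubbardOpenBoxTT'W r c τ υ ν + (μ : ℂ) • totalNumber - (m : ℂ) • 1).PosSemidef := by
  refine posSemidef_sub_smul_one_of_forall_le_groundEnergy
    (isHermitian_add_smul_totalNumber' (hubbardOpenBoxTT'W_isHermitian τ hτ υ ν) μ)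
    ((hubbardOpenBoxTT'W_commute_totalNumber τ υ ν).add_left ((Commute.refl _).smul_left _)) ?_
  intro k hk
  rw [card_rectSites] at hk
  exact le_groundEnergy_add_smul_totalNumber' _ μ m (by rw [card_rectSites]; exact hk) (hm k hk)

/-- **THE WEIGHTED ANDERSON CLUSTER LOWER BOUND, certificate form** (box `r × c` and its transpose with
transposed weights; `a, b ≥ 3`, `r, c ≤ min a b`; `τ` symmetric with `wsumV τ + wsumH τ = t`,
`2 wsumD₁ τ = 2 wsumD₂ τ = t'`, `2 Σ υ = U`, `Σ ν = 0`): certified SECTOR floors `m ≤ E₀(h^W, k) + μ k`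
for every particle number `k ≤ 2rc` of ONE weighted box give, for every `N ≤ 2ab`,
`2ab · m - μ · 2rc · N ≤ E₀(hubbardRectTorusTT' a b t t' U, N)`.
[cite: Anderson1951, eq. (2)] [cite: ValentiStolzeHirschfeld1991, §II] -/
theorem groundEnergy_hubbardRectTorusTT'_ge_of_openBoxW_sectors (ha : 3 ≤ a) (hb : 3 ≤ b) (hr : r ≤ a)
    (hc : c ≤ b) (hc' : c ≤ a) (hr' : r ≤ b) (τ : Fin r ×ₗ Fin c → Fin r ×ₗ Fin c → ℝ) (hτ : ∀ x y, τ x y = τ y x)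
    (υ ν : Fin r ×ₗ Fin c → ℝ) {t t' U : ℝ} (ht : wsumV τ + wsumH τ = t) (hd₁ : 2 * wsumD₁ τ = t')
    (hd₂ : 2 * wsumD₂ τ = t') (hU : 2 * ∑ p, υ p = U) (hν : ∑ p, ν p = 0) (μ m : ℝ)
    (hσ : ∀ k ≤ 2 * (r * c), m ≤ groundEnergy (hubbardOpenBoxTT'W r c τ υ ν) k + μ * k)
    {N : ℕ} (hN : N ≤ 2 * (a * b)) :
    (2 * (a * b) : ℕ) * m - μ * (2 * (r * c) : ℕ) * N ≤ groundEnergy (hubbardRectTorusTT' a b t t' U) N := by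
  set τ' : Fin c ×ₗ Fin r → Fin c ×ₗ Fin r → ℝ := fun p q => τ (rectSwap c r p) (rectSwap c r q) with hτ'def
  set υ' : Fin c ×ₗ Fin r → ℝ := fun p => υ (rectSwap c r p) with hυ'def
  set ν' : Fin c ×ₗ Fin r → ℝ := fun p => ν (rectSwap c r p) with hν'def
  have hτ' : ∀ x y, τ' x y = τ' y x := fun x y => hτ _ _
  have hm := posSemidef_openBoxW_add_smul_totalNumber_of_sectors τ hτ υ ν μ m hσ
  have hσ' : ∀ k ≤ 2 * (c * r), m ≤ groundEnergy (hubbardOpenBoxTT'W c r τ' υ' ν') k + μ * k := fun k hk => by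
    rw [hτ'def, hυ'def, hν'def, groundEnergy_hubbardOpenBoxTT'W_swap]
    exact hσ k (by simpa only [Nat.mul_comm] using hk)
  have hm' := posSemidef_openBoxW_add_smul_totalNumber_of_sectors τ' hτ' υ' ν' μ m hσ'
  have hpos := posSemidef_sum' univ (fun g : Fin a ×ₗ Fin b =>
      fermionEmbed (boxTranslate hr hc g) (hubbardOpenBoxTT'W r c τ υ ν + (μ : ℂ) • totalNumber - (m : ℂ) • 1) +
        fermionEmbed (boxTranslate hc' hr' g) (hubbardOpenBoxTT'W c r τ' υ' ν' + (μ : ℂ) • totalNumber - (m : ℂ) • 1))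
    (fun g _ => (posSemidef_fermionEmbed _ hm).add (posSemidef_fermionEmbed _ hm'))
  have hsum : ∑ g : Fin a ×ₗ Fin b,
      (fermionEmbed (boxTranslate hr hc g) (hubbardOpenBoxTT'W r c τ υ ν + (μ : ℂ) • totalNumber - (m : ℂ) • 1) +
        fermionEmbed (boxTranslate hc' hr' g) (hubbardOpenBoxTT'W c r τ' υ' ν' + (μ : ℂ) • totalNumber - (m : ℂ) • 1)) =
      hubbardRectTorusTT' a b t t' U +
        ((μ * (2 * (r * c) : ℕ) : ℝ) : ℂ) • totalNumber - (((2 * (a * b) : ℕ) * m : ℝ) : ℂ) • 1 := by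
    simp_rw [fermionEmbed_sub, fermionEmbed_add, fermionEmbed_smul, fermionEmbed_one]
    rw [← sum_fermionEmbed_boxTranslate_openBoxW_symm ha hb hr hc hc' hr' τ hτ υ ν ht hd₁ hd₂ hU hν]
    simp only [Finset.sum_add_distrib, Finset.sum_sub_distrib, ← Finset.smul_sum,
      sum_fermionEmbed_boxTranslate_totalNumber, Finset.sum_const, Finset.card_univ, card_rectSites]
    rw [← Nat.cast_smul_eq_nsmul ℂ (a * b)]
    push_cast
    module
  rw [hsum] at hpos
  have h := groundEnergy_ge_of_posSemidef_add_smul_totalNumber' _ _ _ hpos hN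
  push_cast at h ⊢
  linarith

/-! ### §5. Thermodynamic limit and the `2 × 3` table form -/

open ThermodynamicLimit in
/-- **The weighted cluster lower bound in the thermodynamic limit**: under the cover conditions and with
sector floors `m ≤ E₀(h^W_{r×c}, k) + μ k` (`k ≤ 2rc`, `2 ≤ r, c`), the grand-canonical ground-state energy
density at density `0 ≤ n < 2` (`U ≥ 0`) satisfies `2m - 2rc·μ·n ≤ e(t, t', U; n)` (the torus bound on
every `L × L` torus, `L ≥ max 3 r c`, divided by `L²`; Ruelle 1969 §3.3). [cite: Anderson1951, eq. (2)]
[cite: Ruelle1969, §3.3] -/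
theorem energyDensityTT'_ge_of_openBoxW_sectors (τ : Fin r ×ₗ Fin c → Fin r ×ₗ Fin c → ℝ)
    (hτ : ∀ x y, τ x y = τ y x) (υ ν : Fin r ×ₗ Fin c → ℝ) {t t' U : ℝ} (ht : wsumV τ + wsumH τ = t)
    (hd₁ : 2 * wsumD₁ τ = t') (hd₂ : 2 * wsumD₂ τ = t') (hU : 2 * ∑ p, υ p = U) (hν : ∑ p, ν p = 0)
    (hU0 : 0 ≤ U) (μ m : ℝ) (hσ : ∀ k ≤ 2 * (r * c), m ≤ groundEnergy (hubbardOpenBoxTT'W r c τ υ ν) k + μ * k)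
    {n : ℝ} (hn0 : 0 ≤ n) (hn2 : n < 2) :
    2 * m - 2 * (r * c : ℕ) * μ * n ≤ energyDensityTT' t t' U n := by
  refine energyDensityTT'_ge_of_eventually_ge t t' hU0 hn0 hn2 (c := 2 * m - 2 * (r * c : ℕ) * μ * n)
    (μ := -(2 * (r * c : ℕ) * μ)) ?_
  filter_upwards [eventually_ge_atTop (max 3 (max r c))] with L hL
  have hL3 : 3 ≤ L := le_trans (le_max_left _ _) hL
  have hLr : r ≤ L := le_trans (le_trans (le_max_left _ _) (le_max_right _ _)) hL
  have hLc : c ≤ L := le_trans (le_trans (le_max_right _ _) (le_max_right _ _)) hL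
  have hLpos : (0 : ℝ) < (L : ℝ) ^ 2 := by
    have : (3 : ℝ) ≤ L := by exact_mod_cast hL3
    positivity
  have hN : rectN n L ≤ 2 * (L * L) := rectN_le_two_mul hn0 hn2.le L
  have h := groundEnergy_hubbardRectTorusTT'_ge_of_openBoxW_sectors hL3 hL3 hLr hLc hLc hLr τ hτ υ ν ht hd₁ hd₂ hU hν
    μ m hσ hN
  rw [le_div_iff₀ hLpos]
  have e : (2 * m - 2 * (r * c : ℕ) * μ * n + -(2 * (r * c : ℕ) * μ) * ((rectN n L : ℝ) / (L : ℝ) ^ 2 - n)) *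
      (L : ℝ) ^ 2 = 2 * ((L : ℝ) * L) * m - μ * (2 * (r * c : ℕ)) * (rectN n L : ℝ) := by
    field_simp
    ring
  rw [e]
  push_cast at h ⊢
  linarith

open ThermodynamicLimit in
/-- **The weighted `2 × 3` Anderson-cluster lower bound, table form** — drop-in twin of
`energyDensityTT'_ge_of_boxFloors_2x3` for WEIGHTED clusters: if `σ k ≤ E₀(h^W_{2×3}(τ, υ, ν), k)` for
`k ≤ 12` (`τ` symmetric; cover conditions `wsumV τ + wsumH τ = t`, `2 wsumD₁ τ = 2 wsumD₂ τ = t'`,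
`2 Σ υ = U ≥ 0`, `Σ ν = 0`) and `m ≤ σ k + μ k` for those `k`, then for every density `0 ≤ n < 2`:
`2m - 12 μ n ≤ e(t, t', U; n)`. For the `2 × 3` box the conditions say: the four horizontal, the two outer
vertical and the middle vertical bond weights satisfy `4 w_h + 2 w_vo + w_vm = t`; every diagonal weight
class sums to `t'/2`; the corner and middle site repulsions satisfy `2(4 u_c + 2 u_m) = U`; the potentials
sum to zero. [cite: Anderson1951, eq. (2)] [cite: ValentiStolzeHirschfeld1991, §II] [cite: Ruelle1969, §3.3] -/
theorem energyDensityTT'_ge_of_boxFloorsW_2x3 {σ : ℕ → ℝ} {τ : Fin 2 ×ₗ Fin 3 → Fin 2 ×ₗ Fin 3 → ℝ}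
    (hτ : ∀ x y, τ x y = τ y x) {υ ν : Fin 2 ×ₗ Fin 3 → ℝ}
    (hF : ∀ k ≤ 12, σ k ≤ groundEnergy (hubbardOpenBoxTT'W 2 3 τ υ ν) k)
    {t t' U : ℝ} (ht : wsumV τ + wsumH τ = t) (hd₁ : 2 * wsumD₁ τ = t') (hd₂ : 2 * wsumD₂ τ = t')
    (hU : 2 * ∑ p, υ p = U) (hν : ∑ p, ν p = 0) (hU0 : 0 ≤ U)
    (μ m : ℝ) (hm : ∀ k ≤ 12, m ≤ σ k + μ * k) {n : ℝ} (hn0 : 0 ≤ n) (hn2 : n < 2) :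
    2 * m - 12 * μ * n ≤ energyDensityTT' t t' U n := by
  have hσ : ∀ k ≤ 2 * (2 * 3), m ≤ groundEnergy (hubbardOpenBoxTT'W 2 3 τ υ ν) k + μ * k :=
    fun k hk => (hm k hk).trans (by linarith [hF k hk])
  have h := energyDensityTT'_ge_of_openBoxW_sectors τ hτ υ ν ht hd₁ hd₂ hU hν hU0 μ m hσ hn0 hn2
  push_cast at h
  linarith

end ClusterLowerBound

end Literature.MathematicalPhysics.QuantumLattice
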